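import Summits.Ventures.LatticeQCDFlow.Scoring.SU2HaarClassAngle
import HarnessLib

/-!
# SU(2): the characters `χ_n = U_n(a₀)` are Haar-orthonormal, the Haar character coefficients of the Wilson weight are `e^{−2β}(I_n(2β) − I_{n+2}(2β))`, and the weight has the pointwise character expansion `e^{b cos α} sin α = Σ_n (I_n(b) − I_{n+2}(b)) sin((n+1)α)`

HONEST FRAMING: exact (Metropolis-corrected) sampling algorithms for lattice gauge theory;
figures of merit are autocorrelation/cost numbers at stated couplings and volumes; no
continuum-physics claim.

Venture `LatticeQCDFlow` (cell pub-lqcd), sub-topic `Scoring`; FANOUT row 5 (`s0-sun-a`), GEN-9.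
NEW WORK of the cell (placement rule): the CLASS-FUNCTION half of "Peter–Weyl for SU(2)" that the
exact 2-d character formulas use, on the HAAR side (theory-2's `haarProbability SU(2)`), continuing
`Scoring/SU2HaarClassAngle.lean` (Weyl's integration formula
`∫ g(a₀) dHaar = (2/π)∫₀^π g(cos α) sin²α dα`, `a₀ = Re tr U/2`) and GEN-7's class-angle
coefficients `Scoring/OnePlaquetteSU2Characters.lean`
(`(2/π)∫₀^π sin((k+1)α) sin α e^{b cos α} dα = I_k(b) − I_{k+2}(b)`).

The irreducible characters of SU(2) are the Chebyshev polynomials of the second kind in `a₀`: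
`χ_n(U) = U_n(a₀(U))` (spin `n/2`, dimension `χ_n(1) = n + 1`; in the class angle
`U_n(cos α) = sin((n+1)α)/sin α`, Mathlib's `Polynomial.Chebyshev.U_real_cos`).  No new definition
is introduced: `χ_n` is written `(Polynomial.Chebyshev.U ℝ n).eval (su2a0 V)` throughout.

* §1 `integral_sin_succ_mul_sin_succ` — `∫₀^π sin((m+1)α) sin((n+1)α) dα = (π/2)·[m = n]`;
  **`integral_su2Character_mul_su2Character`** — HAAR ORTHONORMALITY
  `∫ χ_m χ_n dHaar_SU(2) = [m = n]` (Mathlib has the `T`-orthogonality; the `U`-orthogonality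
  w.r.t. `√(1 − x²)` is a Mathlib TODO — here in its group-theoretic form).
* §2 **`integral_su2Character_mul_weight`** — the HAAR CHARACTER COEFFICIENTS of theory-2's SU(2)
  Wilson weight: `∫ χ_n(U) e^{−β(2 − tr U)} dHaar(U) = e^{−2β}(I_n(2β) − I_{n+2}(2β))`
  (`= e^{−2β}(n+1) I_{n+1}(2β)/β`, `mul_integral_su2Character_mul_weight`); `n = 0` is `z₁`;
  **`haar_su2_character_expect`** — the character expectations of the one-plaquette law,
  `⟨χ_n⟩_β = (n+1)·I_{n+1}(2β)/I₁(2β)` (`β ≠ 0`; `n = 1`: `⟨tr U⟩ = 2 I₂/I₁`).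
* §3 **`hasSum_besselI_sub_mul_sin`** — the POINTWISE CHARACTER EXPANSION of the one-plaquette
  weight, for all real `b, α`: `e^{b cos α} sin α = Σ_{n ≥ 0} (I_n(b) − I_{n+2}(b)) sin((n+1)α)`
  (from GEN-7's Fourier series `e^{b cos α} = Σ_{m ∈ ℤ} I_{|m|}(b) cos(mα)`, multiplied by `sin α`
  and re-indexed), and `hasSum_besselI_sub_mul_chebyshevU` — for `sin α ≠ 0`,
  `e^{b cos α} = Σ_n (I_n(b) − I_{n+2}(b)) U_n(cos α)`, i.e. `w = Σ_n c_n χ_n` off `U = ±1`.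

NOT here (still NOT TYPED): Schur orthogonality of matrix coefficients / the convolution identity
`χ_m ∗ χ_n = [m = n] χ_n/(n+1)` (the other half of Peter–Weyl, needed for the link integrations of
the exact torus formula `Z_{(ℤ/L)²} = Σ_n (c_n/(n+1))^{L²}`); completeness of `{χ_n}` in the class
functions.
-/

noncomputable section

open Real MeasureTheory intervalIntegral Set Polynomial.Chebyshev
open Literature.MathematicalPhysics.QuantumFieldTheory Literature.MathematicalPhysics.QuantumLattice
open Literature.Analysis.FunctionSpaces
open Summit.Ventures.LatticeQCDFlow.Exactness
open Summit.Ventures.LatticeQCDFlow.Theory2.Lattice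

namespace Summit.Ventures.LatticeQCDFlow.Scoring

/-! ## §1. The characters `χ_n = U_n(a₀)` and their Haar orthonormality -/

/-- `U_n(cos α)·sin α = sin((n+1)α)` for `n ∈ ℕ` (Mathlib's `U_real_cos` at integer index `n`). -/
theorem chebyshevU_eval_cos_mul_sin (n : ℕ) (α : ℝ) :
    (U ℝ n).eval (Real.cos α) * Real.sin α = Real.sin ((n + 1) * α) := by
  have h := U_real_cos α (n : ℤ)
  push_cast at h
  exact h

/-- The dimension of the spin-`n/2` representation: `χ_n(1) = U_n(1) = n + 1`. -/
theorem chebyshevU_eval_one_nat (n : ℕ) : (U ℝ n).eval 1 = n + 1 := by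
  have h := U_eval_one (R := ℝ) (n : ℤ)
  push_cast at h
  exact h

/-- `∫₀^π cos(kα) dα = 0` for a non-zero integer `k`. -/
theorem integral_cos_int_mul_zero_pi {k : ℤ} (hk : k ≠ 0) :
    ∫ α in (0 : ℝ)..π, Real.cos (k * α) = 0 := by
  have hk' : (k : ℝ) ≠ 0 := Int.cast_ne_zero.mpr hk
  have hd : ∀ x ∈ uIcc (0 : ℝ) π,
      HasDerivAt (fun α => Real.sin (k * α) / k) (Real.cos (k * x)) x := by
    intro x _
    have h := (((hasDerivAt_id x).const_mul (k : ℝ)).sin).div_const (k : ℝ)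
    refine h.congr_deriv ?_
    simp only [id]
    field_simp
  rw [integral_eq_sub_of_hasDerivAt hd ((by fun_prop : Continuous fun α : ℝ =>
    Real.cos (k * α)).intervalIntegrable _ _)]
  simp [Real.sin_int_mul_pi]

/-- **`∫₀^π sin((m+1)α) sin((n+1)α) dα = (π/2)·[m = n]`** (`m, n ∈ ℕ`). -/
theorem integral_sin_succ_mul_sin_succ (m n : ℕ) :
    ∫ α in (0 : ℝ)..π, Real.sin ((m + 1) * α) * Real.sin ((n + 1) * α) =
      if m = n then π / 2 else 0 := by
  -- product to sum: `sin A sin B = (cos(A − B) − cos(A + B))/2`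
  have hpt : (fun α : ℝ => Real.sin ((m + 1) * α) * Real.sin ((n + 1) * α)) = fun α =>
      (1 / 2 : ℝ) * Real.cos (((m : ℤ) - n : ℤ) * α) -
        (1 / 2 : ℝ) * Real.cos (((m : ℤ) + n + 2 : ℤ) * α) := by
    funext α
    have h := Real.two_mul_sin_mul_sin ((m + 1) * α) ((n + 1) * α)
    rw [show ((m : ℝ) + 1) * α - ((n : ℝ) + 1) * α = ((m : ℝ) - n) * α by ring,
      show ((m : ℝ) + 1) * α + ((n : ℝ) + 1) * α = ((m : ℝ) + n + 2) * α by ring] at h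
    push_cast
    linarith
  have hc : ∀ c : ℝ, IntervalIntegrable (fun α : ℝ => (1 / 2 : ℝ) * Real.cos (c * α)) volume 0 π :=
    fun c => (by fun_prop : Continuous fun α : ℝ => (1 / 2 : ℝ) * Real.cos (c * α)).intervalIntegrable _ _
  rw [hpt, intervalIntegral.integral_sub (hc _) (hc _), intervalIntegral.integral_const_mul,
    intervalIntegral.integral_const_mul,
    integral_cos_int_mul_zero_pi (k := (m : ℤ) + n + 2) (by omega), mul_zero, sub_zero]
  by_cases h : m = n
  · subst h
    rw [if_pos rfl, sub_self]
    have h0 : ∫ α in (0 : ℝ)..π, Real.cos (((0 : ℤ) : ℝ) * α) = π := by simp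
    rw [h0]
    ring
  · rw [if_neg h, integral_cos_int_mul_zero_pi (k := (m : ℤ) - n) (by omega), mul_zero]

/-- **Haar orthonormality of the SU(2) characters**: `∫ χ_m(U) χ_n(U) dHaar_SU(2)(U) = [m = n]`,
`χ_n(U) = U_n(Re tr U/2)` the character of the `(n+1)`-dimensional irreducible representation
(Weyl's integration formula and `∫₀^π sin((m+1)α) sin((n+1)α) dα = (π/2)[m = n]`). -/
theorem integral_su2Character_mul_su2Character (m n : ℕ) :
    ∫ V, (U ℝ m).eval (su2a0 V) * (U ℝ n).eval (su2a0 V)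
        ∂(haarProbability (Matrix.specialUnitaryGroup (Fin 2) ℂ)) =
      if m = n then 1 else 0 := by
  rw [integral_comp_su2a0_eq_classAngle (fun t => (U ℝ m).eval t * (U ℝ n).eval t)
    (((U ℝ m).continuous).mul ((U ℝ n).continuous))]
  have hpt : (fun α : ℝ => (U ℝ m).eval (Real.cos α) * (U ℝ n).eval (Real.cos α) * Real.sin α ^ 2) =
      fun α => Real.sin ((m + 1) * α) * Real.sin ((n + 1) * α) := by
    funext α
    rw [← chebyshevU_eval_cos_mul_sin m α, ← chebyshevU_eval_cos_mul_sin n α]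
    ring
  rw [hpt, integral_sin_succ_mul_sin_succ]
  by_cases h : m = n
  · rw [if_pos h, if_pos h]; field_simp
  · rw [if_neg h, if_neg h, mul_zero]

/-- The characters are Haar-normalised: `∫ χ_n² dHaar = 1`. -/
theorem integral_su2Character_sq (n : ℕ) :
    ∫ V, ((U ℝ n).eval (su2a0 V)) ^ 2 ∂(haarProbability (Matrix.specialUnitaryGroup (Fin 2) ℂ)) = 1 := by
  have h := integral_su2Character_mul_su2Character n n
  rw [if_pos rfl] at h
  simpa only [sq] using h

/-- Distinct characters are Haar-orthogonal; in particular (`m = 0`, `χ₀ = 1`) every non-trivial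
character has Haar mean zero: `∫ χ_n dHaar = 0` for `n ≠ 0`. -/
theorem integral_su2Character_eq_zero {n : ℕ} (hn : n ≠ 0) :
    ∫ V, (U ℝ n).eval (su2a0 V) ∂(haarProbability (Matrix.specialUnitaryGroup (Fin 2) ℂ)) = 0 := by
  have h := integral_su2Character_mul_su2Character 0 n
  rw [if_neg (Ne.symm hn)] at h
  simpa using h

/-! ## §2. The Haar character coefficients of the SU(2) Wilson weight -/

/-- **The Haar character coefficients of theory-2's SU(2) one-plaquette weight**:
`∫ χ_n(U) e^{−β(2 − tr U)} dHaar_SU(2)(U) = e^{−2β}(I_n(2β) − I_{n+2}(2β))` (`n = 0`: `z₁(β)`,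
`SU2HaarClassAngle.z1_su2_eq_besselI`). -/
theorem integral_su2Character_mul_weight (n : ℕ) (β : ℝ) :
    ∫ V, (U ℝ n).eval (su2a0 V) * Real.exp (-(β * (2 - 2 * su2a0 V)))
        ∂(haarProbability (Matrix.specialUnitaryGroup (Fin 2) ℂ)) =
      Real.exp (-(2 * β)) * (besselI n (2 * β) - besselI (n + 2) (2 * β)) := by
  rw [integral_comp_su2a0_eq_classAngle (fun t => (U ℝ n).eval t * Real.exp (-(β * (2 - 2 * t))))
    (((U ℝ n).continuous).mul (by fun_prop)), ← su2CharCoeff_eq_besselI_sub n (2 * β)]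
  have hpt : (fun α : ℝ => (U ℝ n).eval (Real.cos α) * Real.exp (-(β * (2 - 2 * Real.cos α))) *
      Real.sin α ^ 2) = fun α => Real.exp (-(2 * β)) *
        (Real.sin ((n + 1) * α) * Real.sin α * Real.exp (2 * β * Real.cos α)) := by
    funext α
    rw [exp_neg_mul_two_sub, ← chebyshevU_eval_cos_mul_sin n α]
    ring
  rw [hpt, intervalIntegral.integral_const_mul]
  ring

/-- The closed form by the Bessel recurrence:
`β·∫ χ_n e^{−β(2 − tr U)} dHaar = e^{−2β}(n+1) I_{n+1}(2β)`. -/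
theorem mul_integral_su2Character_mul_weight (n : ℕ) (β : ℝ) :
    β * ∫ V, (U ℝ n).eval (su2a0 V) * Real.exp (-(β * (2 - 2 * su2a0 V)))
        ∂(haarProbability (Matrix.specialUnitaryGroup (Fin 2) ℂ)) =
      Real.exp (-(2 * β)) * ((n + 1) * besselI (n + 1) (2 * β)) := by
  rw [integral_su2Character_mul_weight]
  have h := mul_besselI_sub_besselI_add_two n (2 * β)
  calc β * (Real.exp (-(2 * β)) * (besselI n (2 * β) - besselI (n + 2) (2 * β)))
      = Real.exp (-(2 * β)) * ((2 * β * (besselI n (2 * β) - besselI (n + 2) (2 * β))) / 2) := by ring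
    _ = Real.exp (-(2 * β)) * ((n + 1) * besselI (n + 1) (2 * β)) := by rw [h]; ring

/-- **The character expectations of the SU(2) one-plaquette Haar law**: for `β ≠ 0`,
`⟨χ_n⟩_β = ∫ χ_n e^{−β(2 − tr U)} dHaar / ∫ e^{−β(2 − tr U)} dHaar = (n+1)·I_{n+1}(2β)/I₁(2β)`
(`n = 1`, `χ₁ = tr U`: `⟨tr U⟩ = 2 I₂(2β)/I₁(2β)`, cf. `haar_su2_mean_su2a0_eq_besselI_div`). -/
theorem haar_su2_character_expect (n : ℕ) {β : ℝ} (hβ : β ≠ 0) :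
    (∫ V, (U ℝ n).eval (su2a0 V) * Real.exp (-(β * (2 - 2 * su2a0 V)))
        ∂(haarProbability (Matrix.specialUnitaryGroup (Fin 2) ℂ))) /
      (∫ V, Real.exp (-(β * (2 - 2 * su2a0 V)))
        ∂(haarProbability (Matrix.specialUnitaryGroup (Fin 2) ℂ))) =
      (n + 1) * besselI (n + 1) (2 * β) / besselI 1 (2 * β) := by
  -- numerator and denominator times `β`
  have hnum := mul_integral_su2Character_mul_weight n β
  have hden0 := mul_integral_su2Character_mul_weight 0 β
  simp only [Nat.cast_zero, zero_add, one_mul] at hden0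
  have hden : β * ∫ V, Real.exp (-(β * (2 - 2 * su2a0 V)))
      ∂(haarProbability (Matrix.specialUnitaryGroup (Fin 2) ℂ)) =
      Real.exp (-(2 * β)) * besselI 1 (2 * β) := by
    rw [← hden0]
    congr 1
    refine integral_congr_ae (Filter.Eventually.of_forall fun V => ?_)
    have h0 : (U ℝ 0).eval (su2a0 V) = 1 := by simp
    beta_reduce
    rw [h0, one_mul]
  have he : Real.exp (-(2 * β)) ≠ 0 := (Real.exp_pos _).ne'
  rw [← mul_div_mul_left _ _ hβ, hnum, hden, mul_div_mul_left _ _ he]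

/-! ## §3. The pointwise character expansion of the one-plaquette weight -/

/-- Summability of `m ↦ I_{|m|}(b)·(bounded)` over `ℤ`: the comparison series is
`Σ_m I_{|m|}(|b|) = e^{|b|}`. -/
theorem summable_besselI_natAbs_mul_of_abs_le_one {b : ℝ} {φ : ℤ → ℝ} (hφ : ∀ m, |φ m| ≤ 1) :
    Summable fun m : ℤ => besselI m.natAbs b * φ m := by
  refine Summable.of_norm_bounded (summable_besselI_natAbs |b|) fun m => ?_
  rw [Real.norm_eq_abs, abs_mul, abs_besselI_eq_besselI_abs]
  exact mul_le_of_le_one_right (besselI_nonneg _ (abs_nonneg b)) (hφ m)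

/-- The `ℤ`-indexed form: `e^{b cos α} sin α = Σ_{m ∈ ℤ} I_{|m|}(b) sin((m+1)α)`
(multiply `e^{b cos α} = Σ_m I_{|m|}(b) cos(mα)` by `sin α`, `2 cos(mα) sin α = sin((m+1)α) −
sin((m−1)α)`, and fold the reflection `m ↦ −m`). -/
theorem hasSum_besselI_natAbs_mul_sin_succ (b α : ℝ) :
    HasSum (fun m : ℤ => besselI m.natAbs b * Real.sin ((m + 1) * α))
      (Real.exp (b * Real.cos α) * Real.sin α) := by
  set g : ℤ → ℝ := fun m => besselI m.natAbs b * Real.sin ((m + 1) * α) with hg_def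
  -- `g` is summable
  have hgs : Summable g :=
    summable_besselI_natAbs_mul_of_abs_le_one fun m => Real.abs_sin_le_one _
  -- its reflection has the same sum
  have hneg : HasSum (fun m : ℤ => g (-m)) (∑' m, g m) := by
    have h := (Equiv.neg ℤ).hasSum_iff.mpr hgs.hasSum
    exact h
  -- the symmetrised series is the product series
  have hsym : HasSum (fun m : ℤ => (g m + g (-m)) / 2) (∑' m, g m) := by
    have h := (hgs.hasSum.add hneg).div_const 2
    rw [← two_mul, mul_div_cancel_left₀ _ two_ne_zero] at h
    exact h
  have hprod := (hasSum_besselI_natAbs_mul_cos b α).mul_right (Real.sin α)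
  have hpt : (fun m : ℤ => besselI m.natAbs b * Real.cos (m * α) * Real.sin α) =
      fun m => (g m + g (-m)) / 2 := by
    funext m
    simp only [hg_def, Int.natAbs_neg, Int.cast_neg]
    have h := Real.two_mul_sin_mul_sin ((m + 1) * α) α
    have h1 : Real.sin ((m + 1) * α) + Real.sin ((-(m : ℝ) + 1) * α) =
        2 * (Real.cos (m * α) * Real.sin α) := by
      rw [show (-(m : ℝ) + 1) * α = -((m - 1) * α) by ring, Real.sin_neg,
        show ((m : ℝ) + 1) * α = m * α + α by ring, show ((m : ℝ) - 1) * α = m * α - α by ring,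
        Real.sin_add, Real.sin_sub]
      ring
    rw [← mul_add, h1]
    ring
  rw [hpt] at hprod
  have hS : ∑' m, g m = Real.exp (b * Real.cos α) * Real.sin α := hsym.unique hprod
  rw [← hS]
  exact hgs.hasSum

/-- **The pointwise character expansion of the SU(2) one-plaquette weight** (class-angle form):
for all real `b` and `α`,
`e^{b cos α}·sin α = Σ_{n ≥ 0} (I_n(b) − I_{n+2}(b))·sin((n+1)α)`,
i.e. `w(α) = e^{b cos α} = Σ_n c_n χ_n(α)` with `χ_n(α) sin α = sin((n+1)α)` and the character
coefficients `c_n = I_n − I_{n+2}` of `OnePlaquetteSU2Characters.lean` (absolutely convergent). -/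
theorem hasSum_besselI_sub_mul_sin (b α : ℝ) :
    HasSum (fun n : ℕ => (besselI n b - besselI (n + 2) b) * Real.sin ((n + 1) * α))
      (Real.exp (b * Real.cos α) * Real.sin α) := by
  -- fold the `ℤ`-series onto `ℕ`: the term `m = n ≥ 0` and the term `m = −(n+1)`
  have hZ := (hasSum_besselI_natAbs_mul_sin_succ b α).nat_add_neg_add_one
  have hA' : HasSum (fun n : ℕ => besselI n b * Real.sin ((n + 1) * α) -
      besselI (n + 1) b * Real.sin (n * α)) (Real.exp (b * Real.cos α) * Real.sin α) := by
    refine hZ.congr_fun fun n => ?_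
    have h1 : (-((n : ℤ) + 1)).natAbs = n + 1 := by
      rw [Int.natAbs_neg]; exact Int.natAbs_natCast (n + 1)
    simp only [Int.natAbs_natCast, Int.cast_natCast, h1, Int.cast_neg, Int.cast_add, Int.cast_one]
    rw [show (-((n : ℝ) + 1) + 1) * α = -(n * α) by ring, Real.sin_neg]
    ring
  -- the subtracted series, shifted by one (`n = 0` term vanishes)
  set B : ℕ → ℝ := fun n => besselI (n + 1) b * Real.sin (n * α) with hB_def
  have hBs : Summable B := by
    refine Summable.of_norm_bounded ((summable_besselI_natAbs |b|).comp_injective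
      (show Function.Injective (fun n : ℕ => ((n + 1 : ℕ) : ℤ)) from
        fun m n h => by simpa using h)) fun n => ?_
    simp only [hB_def, Function.comp, Int.natAbs_natCast, Real.norm_eq_abs, abs_mul,
      abs_besselI_eq_besselI_abs]
    exact mul_le_of_le_one_right (besselI_nonneg _ (abs_nonneg b)) (Real.abs_sin_le_one _)
  have hB := hBs.hasSum
  have hB1 : HasSum (fun n : ℕ => B (n + 1)) (∑' n, B n) := by
    have h := (hasSum_nat_add_iff' 1).mpr hB
    simpa [hB_def] using h
  have hAs : Summable fun n : ℕ => besselI n b * Real.sin ((n + 1) * α) := by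
    have h := hA'.summable.add hBs
    refine h.congr fun n => ?_
    simp only [hB_def]; ring
  have hA := hAs.hasSum
  -- identify the sum of `A`: `Σ A = e sin α + Σ B`
  have hAsum : ∑' n, besselI n b * Real.sin ((n + 1) * α) =
      Real.exp (b * Real.cos α) * Real.sin α + ∑' n, B n := by
    have h := hA'.add hB
    have h2 : HasSum (fun n : ℕ => besselI n b * Real.sin ((n + 1) * α))
        (Real.exp (b * Real.cos α) * Real.sin α + ∑' n, B n) := by
      refine h.congr_fun fun n => ?_
      simp only [hB_def]; ring
    exact h2.tsum_eq
  have hfin := hA.sub hB1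
  rw [hAsum, add_sub_cancel_right] at hfin
  refine hfin.congr_fun fun n => ?_
  simp only [hB_def]
  push_cast
  ring

/-- **The character expansion at a generic class angle**: for `sin α ≠ 0` (i.e. `U ≠ ±1`),
`e^{b cos α} = Σ_{n ≥ 0} (I_n(b) − I_{n+2}(b))·U_n(cos α)` — the Wilson weight `e^{b a₀}`-type class
function expanded in the characters `χ_n = U_n(a₀)` with coefficients `c_n(b) = I_n(b) − I_{n+2}(b)`
(`b = 2β` for theory-2's weight `e^{−β(2 − tr U)} = e^{−2β} e^{2β·a₀·2}`… i.e. `e^{−2β}e^{b cos α}`). -/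
theorem hasSum_besselI_sub_mul_chebyshevU (b : ℝ) {α : ℝ} (hα : Real.sin α ≠ 0) :
    HasSum (fun n : ℕ => (besselI n b - besselI (n + 2) b) * (U ℝ n).eval (Real.cos α))
      (Real.exp (b * Real.cos α)) := by
  have h := (hasSum_besselI_sub_mul_sin b α).div_const (Real.sin α)
  rw [mul_div_cancel_right₀ _ hα] at h
  refine h.congr_fun fun n => ?_
  rw [← chebyshevU_eval_cos_mul_sin n α, ← mul_assoc, mul_div_cancel_right₀ _ hα]

end Summit.Ventures.LatticeQCDFlow.Scoring
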